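import Literature.MathematicalPhysics.QuantumFieldTheory.Balaban1983to89.B6BlockDecayGDivFactorsV1

/-!
# `Balaban1983to89.B6BlockDecayGrad2FactorsV1` — T. Bałaban, *Propagators and renormalization transformations for lattice gauge theories. II*,
# Commun. Math. Phys. **96** (1984) 223–250 [Balaban1984PropagatorsII], PROPOSITION 2.5 p. 246, the twice-differentiated `H′_j`-factor of (2.129):
# the block kernel of `∇_λ∇_μ∂H′_j` (third-order derivative kernels of `H′_j`, p. 246 / (2.132)), its row AND column block sums, uniformly at the
# scaling `c = L^j` — the smooth left factor of `∇_λ∇_μK₁`, `∇_λ∇_μK₂*` in the two-derivative members of (1.114) for the two-scale `G` (file 26)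

statement-level skeleton of published theorems with citation tags; proofs where landed; nothing here is a claim about the Yang–Mills mass gap

p. 246 (verbatim, after (2.132)): *"To get the above representation of H′_j we have used only first order derivatives of h(x), thus we can
estimate derivatives of H′_j up to third order by L^{−j} = ξ^{−1}, or max_{y′∈□∼} ξ(y′)^{−1} in general case, hence to estimate the operator
ΔH′_j."*  [4] Prop. 1.2 (1.114) p. 36: *"… ‖ζ∇G∇*J‖, ‖ζ∇∇GJ‖, ‖ζG∇*∇*J‖ ≤ O(1)e^{−δ₀|y−y′|}|ζ|‖J‖ …"*.

CITATION HEADER (lean-in-tree rule) — WHAT IS REPRODUCED.  Phase-2 file of the `lit-balaban` typed skeleton (HOME `run/shared/lean/pub/lit-balaban/`),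
seat **p22 gen 16**, lane B6 §C (fold owner r03, referee ref-4); SKELETON rows **B6.Prop2.5** / **B6.Eq2.132** (cells only).  The third member
of the sequence file 4 (`∂H′_j`, `∂ΔH′_j`: first/third-order kernels), file 8 (`∇_λ∂H′_j`: second-order kernels `dker ![λ, μ₀]`): §1 r03's
iterated-difference kernel of `H′_j` with THREE directions read at fine points, `Re ∂_λ∂_μ∂_{μ₀}H′ = n·(Re ∂_μ∂_{μ₀}H′(· + e_λ) − Re ∂_μ∂_{μ₀}H′)`
(`dker_re_three`, r03's `iterD_succ`); §2 the entries `(∇_λ∇_μ∂H′_j)(e_y)_{b₀} = (c/n)·Re ∂_λ∂_μ∂_{μ(b₀)}H′(EK b₀₋, y)` (`DDgradHp_single_apply`,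
file 8's `Dop_comp_apply` + `DgradHp_single_apply`) and their decay `≤ (|c|/n)·A₃·e^{−κ|y(b₀₋) − y|_T}`, `A₃ = MGHD(d+1,3)·periodConst(κ_N(d+1),d)`
(`abs_DDgradHp_entry_le`: file 4's `abs_dker_re_le` at `m = 3`, r03's `norm_dker_le` BY NAME); §3 the block bounds: rows `(|c|/n·A₃, κ)`
(`blockBound_DDgradHp`, unit sites → fine bonds) and columns `(|c|/n·A₃·n^{d+1}(d+1), κ)` (`blockBound_DDgradHp_adjoint`, file 2's
`blockBound_adjoint_of_entry` with file 5's fibre count).  IMPORTS BY NAME, restating nothing.  THEOREMS ONLY (no `def`, no `def … : Prop`);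
standard axioms.  HONEST SCOPE: (i) per-instance bounds with explicit constants (the uniform packaging at `c = L^j` is left to the composite files);
(ii) `κ = κ_N(d+1)/(d+1)` and `A₃` are r03's (2.132) constants, ours and crude; (iii) finite tori `⟨d + 1, L, m, K, _, _⟩`, `j ≤ m + K`; NOT summit
progress.  Unit `lit-balaban-p22` (gen 16), 2026-08-22.
-/

noncomputable section

open scoped InnerProductSpace BigOperators Matrix
open Finset

namespace Literature.MathematicalPhysics.QuantumFieldTheory.Balaban1983to89.B6BlockDecayGrad2FactorsV1

open LatticeFieldCalculus B5SectBStatements B5Eq117TorusCarriers B6SectADomainsV1 B6SectAOperatorsV1 B6SectAVectorModelV1 B6SectCOperators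
  B6SectCTwoScaleV1 B6SectCTwoScaleV1Lattice B5Eq118OneStroke
open BalabanImbrieJaffe1984to88.BIJ85AxialPropagator411 (BondSpace)
open B4Sect5Torus (IsPseudoDist SumBound)
open B4TorusKernel (periodConst)
open B4TorusKernel.MultiPeriod (torusSupNorm torusSupNorm_nonneg)
open B5Prop11Plancherel (Tor fine)
open B5Action121 (sdiff_mulVec)
open B5Hk163Strip (kappaN kappaN_pos)
open B5Kernel166Decay (periodConst_pos)
open B6LowerBound2153Torus (rep)
open B6Hprime2132Holder (MGHD)
open B6Hprime2132Torus (HpOp iterD dker iterD_succ)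
open B6HprimeOpNormV1 (EK_shift iterD_re_eq_sum card_filter_eq_le_one)
open B6BlockDecayCalculus (blockBound_of_entry blockBound_adjoint_of_entry torusDist_isPseudoDist)
open B6BlockDecayHjCovV1 (card_fiber_src_iterBlockOf_le)
open B6BlockDecayHprimeCovV1 (abs_dker_re_le MGHD_nonneg)
open B6BlockDecayGradFactorsV1 (Dop_comp_apply DgradHp_single_apply)

/-! ## §1  Third-order derivative kernels of `H′_j` read at fine points -/

section Dker3

variable {P : Params} {c : ℝ} (hc : c ≠ 0) {j : ℕ} (hj : j ≤ P.m + P.K) (Λ' : Finset (Site P (j + 1))) (w : CIdx j Λ' → ℝ)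

include hj in
/-- **`Re ∂_λ∂_μ∂_{μ₀}H′ = n·(Re ∂_μ∂_{μ₀}H′(· + e_λ) − Re ∂_μ∂_{μ₀}H′)`** read at fine points `EK x` (r03's `iterD_succ` on the column `H′e_y`; file 8's
`dker_re_two` one order up). [cite: Balaban1984PropagatorsI, (1.4) p.18; Balaban1984PropagatorsII, p.246 («derivatives of H′_j up to third order»)] -/
theorem dker_re_three (lam mu μ₀ : Fin P.d) (x : Site P 0) (y : Site P j) :
    (dker (P.L ^ j) (Mk P j) ![lam, mu, μ₀] (EK hj x) y).re =
      ((P.L : ℝ) ^ j) * ((dker (P.L ^ j) (Mk P j) ![mu, μ₀] (EK hj (x.shift lam)) y).re - (dker (P.L ^ j) (Mk P j) ![mu, μ₀] (EK hj x) y).re) := by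
  classical
  have e : ∀ {mo : ℕ} (νs : Fin mo → Fin P.d) (z : Tor (fine (P.L ^ j) (Mk P j))),
      (dker (P.L ^ j) (Mk P j) νs z y).re =
        (iterD (P.L ^ j) (Mk P j) mo νs (HpOp (P.L ^ j) (Mk P j) *ᵥ cplxS (tSc (WithLp.ofLp (EuclideanSpace.single y (1 : ℝ))))) z).re := by
    intro mo νs z
    rw [iterD_re_eq_sum]
    simp only [PiLp.single_apply, mul_ite, mul_one, mul_zero, Finset.sum_ite_eq', Finset.mem_univ, if_true]
  rw [e, e, e, iterD_succ, sdiff_mulVec, show Fin.tail ![lam, mu, μ₀] = ![mu, μ₀] from Fin.tail_cons _ _,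
    show (![lam, mu, μ₀] : Fin 3 → Fin P.d) 0 = lam from rfl, ← EK_shift hj]
  simp only [Complex.mul_re, Complex.sub_re, Complex.natCast_re, Complex.natCast_im, zero_mul, sub_zero]
  push_cast
  ring

include hj in
/-- **THE ENTRIES OF `∇_λ∇_μ∂H′_j`**: `(∇_λ∇_μ∂H′_j)(e_y)_{b₀} = (c/n)·Re ∂_λ∂_μ∂_{μ(b₀)}H′(EK b₀₋, y)` (file 8's `DgradHp_single_apply` at `b₀` and `b₀ + e_λ`).
[cite: Balaban1984PropagatorsII, p.246 («derivatives of H′_j up to third order»)] -/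
theorem DDgradHp_single_apply (lam mu : Fin P.d) (y : Site P j) (b₀ : PBond P 0) :
    ((((P.L : ℝ) ^ j) • (onE (LinearMap.funLeft ℝ ℝ (fun b : PBond P 0 => (⟨b.src.shift lam, b.dir⟩ : PBond P 0))) - LinearMap.id) :
        BondSpace P →ₗ[ℝ] BondSpace P) ∘ₗ
      (((((P.L : ℝ) ^ j) • (onE (LinearMap.funLeft ℝ ℝ (fun b : PBond P 0 => (⟨b.src.shift mu, b.dir⟩ : PBond P 0))) - LinearMap.id) :
        BondSpace P →ₗ[ℝ] BondSpace P)) ∘ₗ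
        ((tsV1 hc Λ' w).grad ∘ₗ (tsV1 hc Λ' w).hP))) (EuclideanSpace.single y (1 : ℝ)) b₀ =
      c / (P.L : ℝ) ^ j * (dker (P.L ^ j) (Mk P j) ![lam, mu, b₀.dir] (EK hj b₀.src) y).re := by
  rw [Dop_comp_apply, DgradHp_single_apply hc hj Λ' w mu y ⟨b₀.src.shift lam, b₀.dir⟩, DgradHp_single_apply hc hj Λ' w mu y b₀,
    dker_re_three hj]
  ring

end Dker3

/-! ## §2  The entries of `∇_λ∇_μ∂H′_j` decay; §3 its row and column block sums -/

section Block

variable {d L m K : ℕ} [NeZero L] {hd : 1 ≤ d + 1} {hL : Odd L ∧ 1 < L} {c : ℝ} (hc : c ≠ 0) {j : ℕ}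
  (hj : j ≤ (⟨d + 1, L, m, K, hd, hL⟩ : Params).m + (⟨d + 1, L, m, K, hd, hL⟩ : Params).K) (Λ' : Finset (Site (⟨d + 1, L, m, K, hd, hL⟩ : Params) (j + 1))) (w : CIdx j Λ' → ℝ)

include hj in
/-- **THE ENTRIES OF `∇_λ∇_μ∂H′_j` DECAY**: `|(∇_λ∇_μ∂H′_j)(e_y)_{b₀}| ≤ (|c|/n)·A₃·e^{−κ|y(b₀₋) − y|_T}`, `A₃ = MGHD(d+1,3)·periodConst(κ_N(d+1),d)`,
`κ = κ_N(d+1)/(d+1)` (file 4's `abs_dker_re_le`, `m = 3`). [cite: Balaban1984PropagatorsII, p.246 (text after (2.132))] -/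
theorem abs_DDgradHp_entry_le (lam mu : Fin (d + 1)) (y : Site (⟨d + 1, L, m, K, hd, hL⟩ : Params) j) (b₀ : PBond (⟨d + 1, L, m, K, hd, hL⟩ : Params) 0) :
    |((((((L : ℝ) ^ j) • (onE (LinearMap.funLeft ℝ ℝ (fun b : PBond (⟨d + 1, L, m, K, hd, hL⟩ : Params) 0 => (⟨b.src.shift lam, b.dir⟩ : PBond (⟨d + 1, L, m, K, hd, hL⟩ : Params) 0))) - LinearMap.id) : BondSpace (⟨d + 1, L, m, K, hd, hL⟩ : Params) →ₗ[ℝ] BondSpace (⟨d + 1, L, m, K, hd, hL⟩ : Params))) ∘ₗ (((((L : ℝ) ^ j) • (onE (LinearMap.funLeft ℝ ℝ (fun b : PBond (⟨d + 1, L, m, K, hd, hL⟩ : Params) 0 => (⟨b.src.shift mu, b.dir⟩ : PBond (⟨d + 1, L, m, K, hd, hL⟩ : Params) 0))) - LinearMap.id) : BondSpace (⟨d + 1, L, m, K, hd, hL⟩ : Params) →ₗ[ℝ] BondSpace (⟨d + 1, L, m, K, hd, hL⟩ : Params))) ∘ₗ ((tsV1 hc Λ' w).grad ∘ₗ (tsV1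 hc Λ' w).hP))) (EuclideanSpace.single y (1 : ℝ)) b₀)| ≤
      |c| / (L : ℝ) ^ j * (MGHD (d + 1) 3 * periodConst (kappaN (d + 1)) d) * Real.exp (-(kappaN (d + 1) / ((d : ℝ) + 1) *
        torusSupNorm (Mk (⟨d + 1, L, m, K, hd, hL⟩ : Params) j) (rep (Mk (⟨d + 1, L, m, K, hd, hL⟩ : Params) j) (iterBlockOf j b₀.src) - rep (Mk (⟨d + 1, L, m, K, hd, hL⟩ : Params) j) y))) := by
  have hLj : (0 : ℝ) < (L : ℝ) ^ j := pow_pos (Nat.cast_pos.2 (Nat.pos_of_ne_zero (NeZero.ne L))) _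
  have h := DDgradHp_single_apply (P := (⟨d + 1, L, m, K, hd, hL⟩ : Params)) hc hj Λ' w lam mu y b₀
  rw [show ((((⟨d + 1, L, m, K, hd, hL⟩ : Params)).L : ℝ) ^ j) = (L : ℝ) ^ j from rfl] at h
  rw [h, abs_mul, abs_div, abs_of_pos hLj, mul_assoc]
  exact mul_le_mul_of_nonneg_left (abs_dker_re_le hj (by norm_num) ![lam, mu, b₀.dir] b₀.src y) (by positivity)

include hj in
/-- **row block bound for `∇_λ∇_μ∂H′_j`** (unit sites → fine bonds): `(|c|/n·A₃, κ)`. [cite: Balaban1984PropagatorsII, p.246 (text after (2.132))] -/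
theorem blockBound_DDgradHp (lam mu : Fin (d + 1)) (b₀ : PBond (⟨d + 1, L, m, K, hd, hL⟩ : Params) 0) (y : Site (⟨d + 1, L, m, K, hd, hL⟩ : Params) j) :
    ∑ y' ∈ univ.filter (fun y' : Site (⟨d + 1, L, m, K, hd, hL⟩ : Params) j => y' = y),
        |((((((L : ℝ) ^ j) • (onE (LinearMap.funLeft ℝ ℝ (fun b : PBond (⟨d + 1, L, m, K, hd, hL⟩ : Params) 0 => (⟨b.src.shift lam, b.dir⟩ : PBond (⟨d + 1, L, m, K, hd, hL⟩ : Params) 0))) - LinearMap.id) : BondSpace (⟨d + 1, L, m, K, hd, hL⟩ : Params) →ₗ[ℝ] BondSpace (⟨d + 1, L, m, K, hd, hL⟩ : Params))) ∘ₗ (((((L : ℝ) ^ j) • (onE (LinearMap.funLeft ℝ ℝ (fun b : PBond (⟨d + 1, L, m, K, hd, hL⟩ : Params) 0 => (⟨b.src.shift mu, b.dir⟩ : PBond (⟨d + 1, L, m, K, hd, hL⟩ : Params) 0))) - LinearMap.id) : BondSpace (⟨d + 1, L, m, K, hd, hL⟩ : Params) →ₗ[ℝ] BondSpace (⟨d +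 1, L, m, K, hd, hL⟩ : Params))) ∘ₗ ((tsV1 hc Λ' w).grad ∘ₗ (tsV1 hc Λ' w).hP))) (EuclideanSpace.single y' (1 : ℝ)) b₀)| ≤
      |c| / (L : ℝ) ^ j * (MGHD (d + 1) 3 * periodConst (kappaN (d + 1)) d) * ((1 : ℕ) : ℝ) * Real.exp (-(kappaN (d + 1) / ((d : ℝ) + 1) *
        torusSupNorm (Mk (⟨d + 1, L, m, K, hd, hL⟩ : Params) j) (rep (Mk (⟨d + 1, L, m, K, hd, hL⟩ : Params) j) (iterBlockOf j b₀.src) - rep (Mk (⟨d + 1, L, m, K, hd, hL⟩ : Params) j) y))) := by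
  have hLj : (0 : ℝ) < (L : ℝ) ^ j := pow_pos (Nat.cast_pos.2 (Nat.pos_of_ne_zero (NeZero.ne L))) _
  exact blockBound_of_entry (ρ := (fun t t' : Site (⟨d + 1, L, m, K, hd, hL⟩ : Params) j => torusSupNorm (Mk (⟨d + 1, L, m, K, hd, hL⟩ : Params) j) (rep (Mk (⟨d + 1, L, m, K, hd, hL⟩ : Params) j) t - rep (Mk (⟨d + 1, L, m, K, hd, hL⟩ : Params) j) t'))) _ (fun b₀ : PBond (⟨d + 1, L, m, K, hd, hL⟩ : Params) 0 => iterBlockOf j b₀.src) (fun y : Site (⟨d + 1, L, m, K, hd, hL⟩ : Params) j => y)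
    (mul_nonneg (div_nonneg (abs_nonneg c) hLj.le) (mul_nonneg (MGHD_nonneg _ _) (periodConst_pos (kappaN_pos _) _).le))
    (card_filter_eq_le_one (P := (⟨d + 1, L, m, K, hd, hL⟩ : Params)) (j := j)) (fun b₀ y => abs_DDgradHp_entry_le hc hj Λ' w lam mu y b₀) b₀ y

include hj in
open Classical in
/-- **column block bound for `∇_λ∇_μ∂H′_j`** (its adjoint, fine bonds → unit sites; the `n^{d+1}(d+1)` fine bonds over a unit site):
`(|c|/n·A₃·n^{d+1}(d+1), κ)` (file 2's `blockBound_adjoint_of_entry`, file 5's fibre count). [cite: Balaban1984PropagatorsII, p.246 (text after (2.132))] -/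
theorem blockBound_DDgradHp_adjoint (lam mu : Fin (d + 1)) (y' y : Site (⟨d + 1, L, m, K, hd, hL⟩ : Params) j) :
    ∑ b₀ ∈ univ.filter (fun b₀ : PBond (⟨d + 1, L, m, K, hd, hL⟩ : Params) 0 => iterBlockOf j b₀.src = y),
        |LinearMap.adjoint (((((L : ℝ) ^ j) • (onE (LinearMap.funLeft ℝ ℝ (fun b : PBond (⟨d + 1, L, m, K, hd, hL⟩ : Params) 0 => (⟨b.src.shift lam, b.dir⟩ : PBond (⟨d + 1, L, m, K, hd, hL⟩ : Params) 0))) - LinearMap.id) : BondSpace (⟨d + 1, L, m, K, hd, hL⟩ : Params) →ₗ[ℝ] BondSpace (⟨d + 1, L, m, K, hd, hL⟩ : Params))) ∘ₗ (((((L : ℝ) ^ j) • (onE (LinearMap.funLeft ℝ ℝ (fun b : PBond (⟨d + 1, L, m, K, hd, hL⟩ : Params) 0 => (⟨b.src.shift mu, b.dir⟩ : PBond (⟨d + 1, L, m, K, hd, hL⟩ : Params) 0))) - LinearMap.id) : BondSpace (⟨d + 1, L, m, K, hd, hL⟩ : Params) →ₗ[ℝ] BondSpace (⟨d + 1, L,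 m, K, hd, hL⟩ : Params))) ∘ₗ ((tsV1 hc Λ' w).grad ∘ₗ (tsV1 hc Λ' w).hP))) (EuclideanSpace.single b₀ (1 : ℝ)) y'| ≤
      |c| / (L : ℝ) ^ j * (MGHD (d + 1) 3 * periodConst (kappaN (d + 1)) d) * (((L ^ j) ^ (d + 1) * (d + 1) : ℕ) : ℝ) *
        Real.exp (-(kappaN (d + 1) / ((d : ℝ) + 1) * torusSupNorm (Mk (⟨d + 1, L, m, K, hd, hL⟩ : Params) j) (rep (Mk (⟨d + 1, L, m, K, hd, hL⟩ : Params) j) y' - rep (Mk (⟨d + 1, L, m, K, hd, hL⟩ : Params) j) y))) := by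
  have hLj : (0 : ℝ) < (L : ℝ) ^ j := pow_pos (Nat.cast_pos.2 (Nat.pos_of_ne_zero (NeZero.ne L))) _
  exact blockBound_adjoint_of_entry (ρ := (fun t t' : Site (⟨d + 1, L, m, K, hd, hL⟩ : Params) j => torusSupNorm (Mk (⟨d + 1, L, m, K, hd, hL⟩ : Params) j) (rep (Mk (⟨d + 1, L, m, K, hd, hL⟩ : Params) j) t - rep (Mk (⟨d + 1, L, m, K, hd, hL⟩ : Params) j) t'))) (torusDist_isPseudoDist (Mk (⟨d + 1, L, m, K, hd, hL⟩ : Params) j)) _ (fun b₀ : PBond (⟨d + 1, L, m, K, hd, hL⟩ : Params) 0 => iterBlockOf j b₀.src) (fun y : Site (⟨d + 1, L, m, K, hd, hL⟩ : Params) j => y)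
    (mul_nonneg (div_nonneg (abs_nonneg c) hLj.le) (mul_nonneg (MGHD_nonneg _ _) (periodConst_pos (kappaN_pos _) _).le))
    (card_fiber_src_iterBlockOf_le (P := (⟨d + 1, L, m, K, hd, hL⟩ : Params)) hj) (fun b₀ y => abs_DDgradHp_entry_le hc hj Λ' w lam mu y b₀) y' y

end Block

end Literature.MathematicalPhysics.QuantumFieldTheory.Balaban1983to89.B6BlockDecayGrad2FactorsV1

end
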